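import Literature.MathematicalPhysics.QuantumFieldTheory.Balaban1983to89.B9CoReadingCoords
import Literature.MathematicalPhysics.QuantumFieldTheory.Balaban1983to89.B9RWSumsReadsRel

/-!
# `Balaban1983to89.B9RWSumsReadsRelNegative` — the (3.46) co-reading `L2ReadsRel` is REFUTED AT THE κ-FOLD COORDINATE PINS of the record: the
# diagonal evaluation `evBK` over-counts the fibre-L² size of the argument (located obstruction (O1) of the rows-18∕19 reading layer)

T. Bałaban, *Propagators for lattice gauge theories in a background field*, Commun. Math. Phys. **99** (1985) 389–434
[`Balaban1985BackgroundPropagators`, "B9"], (3.46) p. 398 (*"‖h G′(U)λ‖, … ≦ B₀[…]|h|e^{−δ₀d(y,y′)}‖λ‖ for supp h ⊂ Δ(y), y ∈ Λ_j,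
supp λ ⊂ Δ(y′)"*) and (3.39) p. 397; [4] = T. Bałaban, *Propagators and renormalization transformations for lattice gauge theories. II*,
Commun. Math. Phys. **96** (1984) 223–250 [`Balaban1984PropagatorsII`], (2.51)–(2.52) p. 232.

statement-level skeleton of published theorems with citation tags; proofs where landed; nothing here is a claim about the
Yang–Mills mass gap

WHY THIS FILE (negative knowledge of record, located by the owner of the schema, seat n06-k g8; dag-lead DEDUP-255 «welcome»).  The relative
L² co-reading schema `B9RWSumsReadsRel.L2ReadsRel K n U Rel bu bv ev T` (p494292) carries the field `l2bound`: *every fibre-L² size of `ev λ`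
over the class of y′ is ≦ ‖λ‖* — no constant.  n06-d's κ-fold coordinate device (`B9CoReadingCoords`, p498421) pins the evaluation letter of the
rows-18∕19 leaves to `evBK i` (`.inr J ↦ evDiagK J`: the scalar argument placed on the diagonal `a = c′` of EVERY direction slot ν and EVERY
coordinate c′ of the carrier `XBK κ i = FBondY i × Fin (d+1) × κ × κ`), so the fibre-L² size of `evBK (.inr 𝟙_{x₀})` over the fibre of x₀'s
block is `√((d+1)·|κ|)`, while `(geo9K i).l2Norm (.inr 𝟙_{x₀}) = ‖𝟙_{x₀}‖₂ = 1`.  Hence, as soon as the carrier has two distinct direction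
slots (d + 1 ≧ 2; at the record d + 1 = 4) and one coordinate, NO `L2ReadsRel … (RelB i) bu (blkBK i bI) (evBK i) T` holds — for every kernel
family K, every n, U, every observation lattice and every model operator T: the twelve `hl*` binders of a certificate that displays the Rel
species AT THESE PINS are vacuous as typed.  The cure is the owner's re-typing `B9RWSumsReadsNbr.L2ReadsNbr` (`l2bound` with a constant
`Cev`, observation on the metric neighbourhood); this file only records the obstruction in the kernel.

* ★ `not_l2ReadsRel_evBK` — the refutation, hypotheses: a carrier-faithful block map `bI` (n06-d's `hβI`), one fine bond `x₀` lying in the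
  carrier block of an index bond `y′`, two distinct direction slots `ν₀ ≠ ν₁`, one coordinate `c₀`.

HONEST SCOPE.  A statement about two TYPED objects of this tree (a hypothesis schema and an evaluation gadget), not about [B9]: print's (3.46)
is untouched and the positive route is the `…Nbr` species.  NOT a node discharge; count-neutral; one finite 𝕋^{d+1} programme at fixed ε —
nothing continuum, nothing about the mass gap.  Cell `pub-ymgap` (HUMAN RULING D-0062), Track A node N06 [B9], N06-ASSIGNMENT v1 bundle F6
(rows 18–19), seat `pub-ymgap-dag-n06-k` (gen 8), 2026-08-27.
-/

noncomputable section

namespace Literature.MathematicalPhysics.QuantumFieldTheory.Balaban1983to89.B9RWSumsReadsRelNegative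

open B6GlobalChartV1 (blkV1)
open B6Ineq2142KLevelV1 (β)
open B6KLevelCensusIndexV1 (KIdx)
open B9GeoNormsKLevelV1 (geo9K)
open B9CoRealizesRelAtLetters (RelB)
open B9CoReadingCoords (XBK evBK blkBK evDiagK)
open B9Thm34Ext (toB6)
open B9SectDL2Decay (bl2 bsq)
open B9RWSumsReadsRel (L2ReadsRel)
open Node00 (FBondY IBondY)

variable {d ℓ : ℕ} {hd : 1 ≤ d + 1} {hL : Odd (ℓ + 1) ∧ 1 < ℓ + 1} {b₀ b₁ : ℝ}
variable {κ : Type} [Fintype κ] [DecidableEq κ]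
variable (i : KIdx d ℓ hd hL b₀ b₁) {bI : FBondY i → IBondY i}

/-- ★ **THE RELATIVE (3.46) CO-READING IS REFUTED AT THE COORDINATE PINS.**  Let `bI` be carrier-faithful on carrier blocks (n06-d's `hβI`), let the
fine bond `x₀` lie in the carrier block of the index bond `y′`, and let the carrier have two distinct direction slots `ν₀ ≠ ν₁` and a coordinate
`c₀`.  Then for every kernel family `K`, every `n`, `U`, every observation lattice `bu` and model operator `T`:
`¬ L2ReadsRel K n U (RelB i) bu (blkBK i bI) (evBK i) T`.  Proof: the field `l2bound` at λ := 𝟙_{x₀} (supported in Δ(y′)) and the class member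
y″ := bI x₀ gives `bl2 (blkBK i bI) (bI x₀) (evBK (.inr 𝟙_{x₀})) ≤ ‖𝟙_{x₀}‖₂ = 1`, but the two carrier points `(x₀, ν₀, c₀, c₀) ≠ (x₀, ν₁, c₀, c₀)` of
that fibre each contribute `1` to the block square-sum, so the left side is `≥ √2`.
[cite: Balaban1985BackgroundPropagators, (3.46) p.398 + (3.39) p.397; Balaban1984PropagatorsII, (2.51)–(2.52) p.232 (located negative, bookkeeping)] -/
theorem not_l2ReadsRel_evBK [Fintype (geo9K i).Site] [DecidableRel (RelB i)] {B : B9.Backgrounds} (K : B9.KernelFamily (geo9K i) B) (n : Fin 6) (U : B.Cfg)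
    {u : Type} [Fintype u] (bu : u → IBondY i) (T : (XBK κ i → ℝ) →ₗ[ℝ] (u → ℝ)) {R : ℝ} {H : Prop}
    (hβI : ∀ (x : FBondY i) (c : IBondY i), blkV1 i.hN i.D x = β i.hN i.D i.hk c → β i.hN i.D i.hk (bI x) = blkV1 i.hN i.D x)
    (x₀ : FBondY i) (y' : IBondY i) (hx₀ : blkV1 i.hN i.D x₀ = β i.hN i.D i.hk y')
    (ν₀ ν₁ : Fin (d + 1)) (hν : ν₀ ≠ ν₁) (c₀ : κ) :
    ¬ L2ReadsRel (R := R) (H := H) K n U (RelB i) bu (blkBK i bI) (evBK i) T := by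
  classical
  intro hR
  -- the argument 𝟙_{x₀}, supported in the carrier block of y′
  set J : FBondY i → ℝ := fun x => if x = x₀ then (1 : ℝ) else 0 with hJ
  have hs : (geo9K i).suppIn (Sum.inr J : (geo9K i).Loc) y' := by
    intro x hx
    have hxx : x = x₀ := by
      by_contra h
      exact hx (by simp [hJ, h])
    subst hxx
    show blkV1 i.hN i.D x = β i.hN i.D i.hk y'
    exact hx₀
  have hrel : RelB i (bI x₀) y' := (hβI x₀ y' hx₀).trans hx₀
  have hle := hR.l2bound (Sum.inr J) y' (bI x₀) hs hrel
  -- the right side: ‖𝟙_{x₀}‖₂ = 1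
  have hsq : ∀ x, J x ^ 2 = J x := fun x => by
    simp only [hJ]
    split_ifs <;> norm_num
  have hnorm : (geo9K i).l2Norm (Sum.inr J : (geo9K i).Loc) = 1 := by
    show Real.sqrt (∑ x, J x ^ 2) = 1
    simp_rw [hsq]
    rw [show ∑ x, J x = 1 by simp [hJ, Finset.sum_ite_eq'], Real.sqrt_one]
  -- the left side: two carrier points of the fibre of bI x₀ contribute 1 each
  set p₀ : XBK κ i := (x₀, ν₀, c₀, c₀) with hp₀
  set p₁ : XBK κ i := (x₀, ν₁, c₀, c₀) with hp₁
  have hp : p₀ ≠ p₁ := by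
    intro h
    exact hν (by simpa [hp₀, hp₁] using congrArg (fun p : XBK κ i => p.2.1) h)
  have hJx₀ : J x₀ = 1 := by simp [hJ]
  have he₀ : evBK i (Sum.inr J : (geo9K i).Loc) p₀ = 1 := by
    show evDiagK J p₀ = 1
    rw [show evDiagK J p₀ = J x₀ from if_pos rfl, hJx₀]
  have he₁ : evBK i (Sum.inr J : (geo9K i).Loc) p₁ = 1 := by
    show evDiagK J p₁ = 1
    rw [show evDiagK J p₁ = J x₀ from if_pos rfl, hJx₀]
  have hbsq : (2 : ℝ) ≤ bsq (g := toB6 (geo9K i) R H) (blkBK (κ := κ) i bI) (bI x₀) (evBK i (Sum.inr J : (geo9K i).Loc)) := by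
    unfold bsq
    refine le_trans ?_ (Finset.sum_le_sum_of_subset_of_nonneg (Finset.subset_univ ({p₀, p₁} : Finset (XBK κ i)))
      (fun p _ _ => ?_))
    · rw [Finset.sum_pair hp]
      split_ifs <;> first | (rw [he₀, he₁]; norm_num) | (exfalso; exact absurd rfl ‹¬_›)
    · split_ifs <;> positivity
  have hbl2 : Real.sqrt 2 ≤ bl2 (g := toB6 (geo9K i) R H) (blkBK (κ := κ) i bI) (bI x₀) (evBK i (Sum.inr J : (geo9K i).Loc)) :=
    Real.sqrt_le_sqrt hbsq
  have h12 : (1 : ℝ) < Real.sqrt 2 := by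
    rw [show (1 : ℝ) = Real.sqrt 1 from Real.sqrt_one.symm]
    exact Real.sqrt_lt_sqrt (by norm_num) (by norm_num)
  rw [hnorm] at hle
  linarith

end Literature.MathematicalPhysics.QuantumFieldTheory.Balaban1983to89.B9RWSumsReadsRelNegative

end
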